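import Literature.Computability.AlgebraicComplexity.GrenetEquivariant

/-!
# Route RigidityForcesSymmetry — `GrenetFirstOrderRankRigid` (item stmt-ValiantsHypothesis-21029),
line `grenet_gauge`: stub `stub_pencil` (Grenet's matrix is the affine pencil of its coefficients)

Bookkeeping for the crux line `Cruxes/GrenetFirstOrderRankRigid/Lines/grenet_gauge.lean`: a matrix of
polynomials of total degree `≤ 1` is the affine pencil `Λ + Σ_v x_v A_v` of its constant part
`Λ = (coeff 0)` and its coefficient matrices `A_v = (coeff x_v)`; applied to Grenet's matrix
`Grenet.repr k n e` (whose entries have total degree `≤ 1`, `Grenet.isAffineDetRepr_repr`) and ANY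
enumeration `e` of the vertices, this is the line's `stub_pencil` (there `e = enumSubsets n`,
`Λ = gΛ n`, `A_v = gA n v`, and the stub follows by `exact grenet_pencil_eq …`, the line's
definitions unfolding to the terms below).

Main statements: `pencil_eq_of_totalDegree_le_one` (any matrix of affine entries),
`grenet_pencil_eq` (Grenet's matrix).  No new definitions.  VP ≠ VNP is not moved by this file
(bookkeeping for a first-order statement about one explicit matrix family).
-/

noncomputable section

open MvPolynomial Matrix Finset

namespace Summit.ValiantsHypothesis.Theorems.RigidityForcesSymmetry.GrenetGauge

open Literature.Computability.AlgebraicComplexity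

variable {k : Type*} [CommSemiring k]

/-- A nonzero exponent vector of degree `≤ 1` is a single variable. [folklore] -/
private theorem exists_eq_single_of_degree_le_one {σ : Type*} {d : σ →₀ ℕ} (h0 : d ≠ 0)
    (h : (d.sum fun _ e => e) ≤ 1) : ∃ v, d = Finsupp.single v 1 := by
  rcases Nat.le_one_iff_eq_zero_or_eq_one.1 h with h | h
  · exact absurd ((Finsupp.degree_eq_zero_iff d).1 h) h0
  · exact (Finsupp.sum_eq_one_iff d).1 h

/-- **Affine decomposition of a polynomial of total degree `≤ 1`**:
`p = p(0) + Σ_v x_v · coeff_{x_v}(p)`. [folklore] -/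
theorem eq_C_add_sum_X_mul_C_of_totalDegree_le_one {σ : Type*} [Fintype σ] (p : MvPolynomial σ k)
    (hp : p.totalDegree ≤ 1) :
    p = C (coeff 0 p) + ∑ v, X v * C (coeff (Finsupp.single v 1) p) := by
  classical
  have hcomm : ∀ v : σ, (X v : MvPolynomial σ k) * C (coeff (Finsupp.single v 1) p)
      = C (coeff (Finsupp.single v 1) p) * X v := fun v => mul_comm _ _
  simp_rw [hcomm]
  apply MvPolynomial.ext
  intro d
  simp only [MvPolynomial.coeff_add, MvPolynomial.coeff_C, MvPolynomial.coeff_sum,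
    MvPolynomial.coeff_C_mul, MvPolynomial.coeff_X]
  by_cases h0 : d = 0
  · subst h0
    rw [if_pos rfl]
    have : ∀ v : σ, (Finsupp.single v 1 = (0 : σ →₀ ℕ)) = False := fun v =>
      propext ⟨fun h => one_ne_zero (Finsupp.single_eq_zero.1 h), False.elim⟩
    simp [this]
  · rw [if_neg (Ne.symm h0), zero_add]
    by_cases h1 : ∃ v, d = Finsupp.single v 1
    · obtain ⟨v, rfl⟩ := h1
      rw [Finset.sum_eq_single v]
      · rw [if_pos rfl, mul_one]
      · intro w _ hw
        rw [if_neg (fun h => hw (Finsupp.single_left_injective one_ne_zero h)), mul_zero]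
      · simp
    · have hd : coeff d p = 0 := by
        rw [← MvPolynomial.notMem_support_iff]
        intro hmem
        exact h1 (exists_eq_single_of_degree_le_one h0 ((le_totalDegree hmem).trans hp))
      rw [hd]
      symm
      refine Finset.sum_eq_zero fun w _ => ?_
      rw [if_neg (fun h => h1 ⟨w, h.symm⟩), mul_zero]

/-- **A matrix of affine entries is the affine pencil of its coefficient matrices**: if every entry
of `M` has total degree `≤ 1` then `M = Λ + Σ_v x_v A_v` with `Λ = (coeff 0 ∘ M)` the constant part
and `A_v = (coeff x_v ∘ M)` the coefficient matrix of `x_v`. [folklore] -/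
theorem pencil_eq_of_totalDegree_le_one {σ : Type*} [Fintype σ] {ι κ : Type*}
    (M : Matrix ι κ (MvPolynomial σ k)) (hM : ∀ i j, (M i j).totalDegree ≤ 1) :
    Matrix.map (fun i j => coeff 0 (M i j) : Matrix ι κ k) C
        + ∑ v, (X v : MvPolynomial σ k) •
            Matrix.map (fun i j => coeff (Finsupp.single v 1) (M i j) : Matrix ι κ k) C
      = M := by
  refine Matrix.ext fun i j => ?_
  rw [Matrix.add_apply, Matrix.sum_apply, Matrix.map_apply]
  simp only [Matrix.smul_apply, Matrix.map_apply, smul_eq_mul]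
  exact (eq_C_add_sum_X_mul_C_of_totalDegree_le_one (M i j) (hM i j)).symm

/-- **Grenet's matrix is the affine pencil of its coefficient matrices** (`n ≠ 0`, `2ⁿ = N + 1`,
any vertex enumeration `e`): `Grenet.repr k n e = Λ + Σ_v x_v A_v` with `Λ_{ij} = coeff_0` and
`(A_v)_{ij} = coeff_{x_v}` of the `(i, j)` entry — the entries have total degree `≤ 1` by
`Grenet.isAffineDetRepr_repr`.  This is stub `stub_pencil` of the line `grenet_gauge` for every
`e` (the line takes `e = enumSubsets n`). [cite: Grenet2011, Thm. 1] -/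
theorem grenet_pencil_eq {k : Type*} [CommRing k] [Nontrivial k] (n : ℕ) (hn : n ≠ 0) {N : ℕ}
    (hN : 2 ^ n = N + 1) (e : Finset (Fin n) ≃ Fin (N + 1)) :
    Matrix.map (fun i j => coeff 0 (Grenet.repr k n e i j) : Matrix (Fin N) (Fin N) k) C
        + ∑ v, (X v : MvPolynomial (Fin n × Fin n) k) •
            Matrix.map (fun i j => coeff (Finsupp.single v 1) (Grenet.repr k n e i j) : Matrix (Fin N) (Fin N) k) C
      = Grenet.repr k n e :=
  pencil_eq_of_totalDegree_le_one _ (Grenet.isAffineDetRepr_repr k n hn hN e).1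

end Summit.ValiantsHypothesis.Theorems.RigidityForcesSymmetry.GrenetGauge
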